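import Summits.HodgeConjecture.HodgeConjecture.Theorems.R90S4TwistedTubeFormula                  -- ★ p864988 (this seat) (B1-T) part 3: `integrableOn_and_index_mul_setIntegral_epsTube_eq` (letter (3))
import Summits.HodgeConjecture.HodgeConjecture.Theorems.R90S4TwistedTubeApparatus                -- (this seat) §1a: `exists_twistedTubeApparatus`
import Summits.HodgeConjecture.HodgeConjecture.Theorems.R90S4EpsNormTubeEqImage                  -- ★ p864960 (p05 g3) (T-EQ-IMG) `setOf_exists_isEpsNormPair_eq_image_epsTube`
import Summits.HodgeConjecture.HodgeConjecture.Theorems.R90S4TwistedWeylMeasureOfOneTubeFormulas -- ★ p865008 (this seat) (B1-Σ) core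
import Summits.HodgeConjecture.HodgeConjecture.Theorems.R90S4EpsSingularNull                    -- ★ p864222 (p04) SING-ε `measure_setOf_not_isEpsRegularAt_splitFormGL_eq_zero`
import HarnessLib

/-!
# R90-TF · S4 «Ch. 13.1–2», T-WIF road, (B1-Σ) head UNDER LETTER (3) — the one-tube formula of a member from the (J̃♭) letter in its uniform-window form (3), and the twisted Weyl
# measure from those letters (a bankable sibling of the Σ-head of record, which consumes the localised letter (3′)) (Rogawski 1990, §12.5 p. 186)

Cell `hodgecm-mathlib`, crux H413 (`stmt-HodgeConjecture-24833`, lane `--supports … --as helper`), route of record `HCCMUnconditional` (no route verbs; count-neutral).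
Programme R90-TF, section S4 = [Rogawski1990] Ch. 13.1–13.2; seat R90-C131-p03 (g3).  REHEARSAL-GRADE SIBLING of K2E3-p36 (g4)'s Σ-head `R90S4TwistedWeylMeasureOfTubeJacobians`
(which consumes C ED. 6's (J̃♭) socket in the (3′) form): the SAME composition with the letter in the (3) form of R90 bus 02:06:56Z — it certifies that ★ (B1-T) part 3, ★ §1a
apparatus, ★ (T-EQ-IMG) and ★ Σ-core compose at a member `T := ↑i` of `Gqs`-typed Cartan data with no carrier friction.  THEOREMS ONLY — no `def`, no instance, no notation, no
named-fact hypothesis, no `sorry`; ★-only imports.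

HONEST LABEL: HC_CM is proved only modulo the 7 printed citations (2 remaining named inputs: hLiu418 = stmt-HodgeConjecture-24832, h413 =
stmt-HodgeConjecture-24833) until rung 0 closes.  CONDITIONAL on the (J̃♭) letters in form (3) (`hJac`), on (WEYL-COUNT-T) (`hwc`) and SING-ε (`hsing`) — hypotheses; NOT the socket's
letter of record ((3′)); discharges no socket (REL ≠ ★ ≠ BUILT).

## The mathematics

§1 ONE MEMBER: for `T = Cent_{G_v}(γ₀)` (`γ₀` regular), `mGt` canonical, `sec₀` a norm section, and the letter (3) for EVERY apparatus `(δ₀, τ′, Ψ, Ñ, s, R)` over `T` (as the socket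
quantifies), the ONE-TUBE formula of ★ Σ-core holds at `T`: choose the apparatus (★ §1a `exists_twistedTubeApparatus`), apply ★ part 3 `integrableOn_and_index_mul_setIntegral_epsTube_eq`
with the GIVEN ε-normaliser, and rename the tube `Ψ(D)` into the norm tube (★ T-EQ-IMG).  §2 THE HEAD UNDER (3): ★ Σ-core `isTwistedWeylMeasure_stableCartanMeasure_of_oneTubeFormulas`
fed with §1 at every member.

[cite: Rogawski1990, §12.5 pp. 182, 186–187; §4.3 (4.3.1) p. 43; §4.10 (4.10.1) p. 57] [cite: HarishChandra1970, Lemma 22; Lemma 42] [cite: Federer1969, §2.10.10]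
-/

set_option autoImplicit false
-- the mandated namespace repeats the single-problem summit's segment (`HodgeConjecture.HodgeConjecture`)
set_option linter.dupNamespace false

noncomputable section

open MeasureTheory Measure Set Filter Topology Function NumberField IsDedekindDomain
open Literature.MeasureTheory.Group
open Literature.NumberTheory.Automorphic Literature.NumberTheory.Automorphic.UnitaryGroup Literature.NumberTheory.Rogawski1990
open Literature.NumberTheory.Rogawski1990.Ch4Sec10
open Summit.HodgeConjecture.HodgeConjecture.Cruxes.H413
open Summit.HodgeConjecture.HodgeConjecture.Cruxes.H413.F0P3cStCharTSWeylCartanRadial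
open scoped ENNReal NNReal MatrixGroups Pointwise

namespace Summit.HodgeConjecture.HodgeConjecture.R90.S4

section HeadUnderLetter3

variable (L : Type) [Field L] [NumberField L] [IsCMField L] (v : HeightOneSpectrum (𝓞 ↥(maximalRealSubfield L)))

/-- **ONE-TUBE FROM THE LETTER (3) AT A MEMBER.**  For a Cartan member `T = Cent_{G_v}(γ₀)` (`γ₀` regular, `v` non-split), its core-one Haar `tT`, `mGt` canonical for the Haar
`νGt`, a norm section `sec₀`, and the (J̃♭) letter (3) for every apparatus over `T`: the ONE-TUBE formula of ★ Σ-core at `T` — for every ε-normaliser `Ñ`, every integrable `φβ` with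
`β` ε-stable, `t ↦ D_T(t) • Φ^{st}_ε(sec₀ t, φ) β(sec₀ t)` is `t_T`-integrable on `T^{reg}` and `[Ñ : T̃] · ∫_{tube T} φβ dνGt = ∫_{T^{reg}} D_T • Φ^{st}_ε(sec₀ t) β(sec₀ t) dt_T`.
[cite: Rogawski1990, §12.5 p. 186; §4.10 (4.10.1) p. 57] [cite: HarishChandra1970, Lemma 42] -/
theorem oneTubeFormula_of_sheetJacobian (hns : ∀ w : PlacesOver L v, IsCMField.complexConj L • w.1 = w.1)
    [LocallyCompactSpace (GtLoc L v)] [SecondCountableTopology (GtLoc L v)] [T2Space (GtLoc L v)]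
    [MeasurableSpace (GtLoc L v)] [BorelSpace (GtLoc L v)] [MeasurableSpace (Gqs L v)] [BorelSpace (Gqs L v)]
    [∀ δ : GtLoc L v, MeasurableSpace (GtLoc L v ⧸ epsCentralizer (epsLoc L (splitFormGL L) v) δ)] [∀ δ : GtLoc L v, BorelSpace (GtLoc L v ⧸ epsCentralizer (epsLoc L (splitFormGL L) v) δ)]
    (νGt : Measure (GtLoc L v)) [νGt.IsHaarMeasure] [νGt.IsMulRightInvariant]
    (mGt : EpsOrbitalMeasureFamily (epsLoc L (splitFormGL L) v) ⊥) (hcan : IsEpsCanonicalAt L (splitFormGL L) v νGt mGt)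
    {T : Subgroup (Gqs L v)} {γ₀ : Gqs L v} (hγ₀ : IsRegularElt (γ₀.val : GtLoc L v)) (hT : T = Subgroup.centralizer ({γ₀} : Set (Gqs L v)))
    (tT : Measure ↥T) [tT.IsHaarMeasure]
    (sec₀ : Gqs L v → GtLoc L v) (hsec₀ : ∀ γ : Gqs L v, IsEpsNormPair L (splitFormGL L) v (sec₀ γ) γ)
    (hJac : ∀ ⦃δ₀ : GtLoc L v⦄ (hδ₀T : δ₀ ∈ (Subgroup.centralizer ({(γ₀.val : GtLoc L v)} : Set (GtLoc L v)))) (hδ₀reg : IsEpsRegularAt L (splitFormGL L) v δ₀)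
      (τ' : Measure ↥(epsCentralizer (epsLoc L (splitFormGL L) v) δ₀)) [τ'.IsHaarMeasure] [τ'.IsInvInvariant]
      (h1 : τ' (compactCore ↥(epsCentralizer (epsLoc L (splitFormGL L) v) δ₀)) = 1)
      (Ψ : (GtLoc L v ⧸ epsCentralizer (epsLoc L (splitFormGL L) v) δ₀) × ↥(Subgroup.centralizer ({(γ₀.val : GtLoc L v)} : Set (GtLoc L v))) → GtLoc L v)
      (hΨ : ∀ (x : GtLoc L v) (b : ↥(Subgroup.centralizer ({(γ₀.val : GtLoc L v)} : Set (GtLoc L v)))), Ψ (QuotientGroup.mk x, b) = x * b * ((epsLoc L (splitFormGL L) v) x)⁻¹)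
      (N' : Subgroup (GtLoc L v))
      (hN' : ∀ m, m ∈ N' ↔ m ∈ Subgroup.normalizer ((Subgroup.centralizer ({(γ₀.val : GtLoc L v)} : Set (GtLoc L v))) : Set (GtLoc L v)) ∧ m * ((epsLoc L (splitFormGL L) v) m)⁻¹ ∈ (Subgroup.centralizer ({(γ₀.val : GtLoc L v)} : Set (GtLoc L v))))
      (s : ↥T → ↥(Subgroup.centralizer ({(γ₀.val : GtLoc L v)} : Set (GtLoc L v)))) (hsm : Measurable s) (hsN : ∀ t : ↥T, epsNorm (epsLoc L (splitFormGL L) v) (s t : GtLoc L v) = ((t : Gqs L v)).val)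
      (R : Finset ↥(Subgroup.centralizer ({(γ₀.val : GtLoc L v)} : Set (GtLoc L v)))) (hRN : ∀ u ∈ R, epsNorm (epsLoc L (splitFormGL L) v) (u : GtLoc L v) = 1)
      (hRcov : ∀ w : ↥(Subgroup.centralizer ({(γ₀.val : GtLoc L v)} : Set (GtLoc L v))), epsNorm (epsLoc L (splitFormGL L) v) (w : GtLoc L v) = 1 → ∃ u ∈ R, ∃ a : ↥(Subgroup.centralizer ({(γ₀.val : GtLoc L v)} : Set (GtLoc L v))), (w : GtLoc L v) = u * (a * ((epsLoc L (splitFormGL L) v) a)⁻¹))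
      (hRinj : ∀ u ∈ R, ∀ u' ∈ R, (∃ a : ↥(Subgroup.centralizer ({(γ₀.val : GtLoc L v)} : Set (GtLoc L v))), ((u' : ↥(Subgroup.centralizer ({(γ₀.val : GtLoc L v)} : Set (GtLoc L v)))) : GtLoc L v) = u * (a * ((epsLoc L (splitFormGL L) v) a)⁻¹)) → u = u'),
      ∀ t₁ : ↥T, IsRegularElt (((t₁ : Gqs L v)).val : GtLoc L v) →
        ∃ U : Set ↥T, IsOpen U ∧ t₁ ∈ U ∧
        ∃ A₀ : Set (GtLoc L v ⧸ epsCentralizer (epsLoc L (splitFormGL L) v) δ₀), MeasurableSet A₀ ∧ (Literature.MeasureTheory.Group.quotientMeasure (epsCentralizer (epsLoc L (splitFormGL L) v) δ₀) τ' (isClosed_epsCentralizer L (splitFormGL L) v δ₀) νGt) A₀ ≠ 0 ∧ (Literature.MeasureTheory.Group.quotientMeasure (epsCentralizer (epsLoc L (splitFormGL L) v) δ₀) τ' (isClosed_epsCentralizer L (splitFormGL L) v δ₀) νGt) A₀ ≠ ⊤ ∧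
          ∀ u ∈ R, ∀ V : Set ↥T, MeasurableSet V → V ⊆ U ∩ {t : ↥T | IsRegularElt (((t : Gqs L v)).val : GtLoc L v)} →
            νGt (Ψ '' (A₀ ×ˢ ((fun t : ↥T => s t * u) '' V))) = (Literature.MeasureTheory.Group.quotientMeasure (epsCentralizer (epsLoc L (splitFormGL L) v) δ₀) τ' (isClosed_epsCentralizer L (splitFormGL L) v δ₀) νGt) A₀ * ∫⁻ t in V, (cartanWeight L v T t : ℝ≥0∞) ∂tT) :
    ∀ N' : Subgroup (GtLoc L v),
      (∀ m : GtLoc L v, m ∈ N' ↔ m ∈ Subgroup.normalizer ((Subgroup.centralizer ({(γ₀.val : GtLoc L v)} : Set (GtLoc L v))) : Set (GtLoc L v)) ∧ m * ((epsLoc L (splitFormGL L) v) m)⁻¹ ∈ (Subgroup.centralizer ({(γ₀.val : GtLoc L v)} : Set (GtLoc L v)))) →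
    ∀ φ β : GtLoc L v → ℂ, Integrable (fun y => φ y * β y) νGt →
      (∀ δ δ' : GtLoc L v, IsStablyEpsConjAt L (splitFormGL L) v δ δ' → β δ = β δ') →
      IntegrableOn (fun t : ↥T => (cartanWeight L v T t : ℝ) •
          (stableEpsOrbitalIntegral L (splitFormGL L) v mGt φ (sec₀ (t : Gqs L v)) * β (sec₀ (t : Gqs L v)))) {t : ↥T | IsRegularElt (((t : Gqs L v)).val : GL (Fin 3) (LocalRing L v))} tT ∧
      ((((Subgroup.centralizer ({(γ₀.val : GtLoc L v)} : Set (GtLoc L v))).subgroupOf N').index : ℕ) : ℂ) * ∫ y in {δ : GtLoc L v | ∃ t : ↥T, IsRegularElt (((t : Gqs L v)).val : GL (Fin 3) (LocalRing L v)) ∧ IsEpsNormPair L (splitFormGL L) v δ (t : Gqs L v)}, φ y * β y ∂νGt =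
        ∫ t in {t : ↥T | IsRegularElt (((t : Gqs L v)).val : GL (Fin 3) (LocalRing L v))}, (cartanWeight L v T t : ℝ) •
          (stableEpsOrbitalIntegral L (splitFormGL L) v mGt φ (sec₀ (t : Gqs L v)) * β (sec₀ (t : Gqs L v))) ∂tT := by
  intro N' hN' φ β hφβ hβ
  obtain ⟨δ₀, hδ₀T, hδ₀reg, τ', hτH, hτI, h1, Ψ, hΨ, -, -, s, hsm, hsN, R, hRN, hRcov, hRinj⟩ := exists_twistedTubeApparatus hns hγ₀ hT
  haveI := hτH
  haveI := hτI
  -- `T` is closed in the lcsc `G_v`, so its Haar measure is σ-finite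
  haveI : LocallyCompactSpace (Gqs L v) := locallyCompactSpace_cmDatum_local (L := L) (N := 3) (H := qsForm L) (v := v)
  haveI : SecondCountableTopology (GL (Fin 3) (LocalRing L v)) := secondCountableTopology_localGL (E := L) 3 v
  haveI : SecondCountableTopology (Gqs L v) := TopologicalSpace.Subtype.secondCountableTopology _
  have hTcl : IsClosed (T : Set (Gqs L v)) := by rw [hT]; exact Set.isClosed_centralizer _
  haveI : LocallyCompactSpace ↥T := hTcl.isClosedEmbedding_subtypeVal.locallyCompactSpace
  haveI : SecondCountableTopology ↥T := TopologicalSpace.Subtype.secondCountableTopology _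
  haveI : SigmaCompactSpace ↥T := sigmaCompactSpace_of_locallyCompact_secondCountable
  haveI : SigmaFinite tT := SigmaFinite.of_isFiniteMeasureOnCompacts _
  obtain ⟨hint, heq⟩ := integrableOn_and_index_mul_setIntegral_epsTube_eq hns hγ₀ hT hδ₀T hδ₀reg Ψ hΨ N' hN' s hsm hsN R hRN hRcov hRinj tT τ' νGt mGt hcan h1
    (hJac hδ₀T hδ₀reg τ' h1 Ψ hΨ N' hN' s hsm hsN R hRN hRcov hRinj) φ β hφβ.integrableOn hβ sec₀ hsec₀
  refine ⟨hint, ?_⟩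
  rw [setOf_exists_isEpsNormPair_eq_image_epsTube hγ₀ hT Ψ hΨ s hsN R hRN hRcov]
  exact heq

/-- **THE TWISTED WEYL MEASURE FROM THE LETTERS (3)** — the (B1) head under the uniform-window letter: Cartan data with the ★ CARTAN-ALL letters, core-one inversion-invariant Haar
measures `tT`, a stable-transport dictionary, a Haar `νGt` with SING-ε, `mGt` canonical, a norm section `sec₀`, (WEYL-COUNT-T), and the letter (3) at every member ⇒
`IsTwistedWeylMeasure L (splitFormGL L) v νGt mGt (stableCartanMeasure L v C tT n) sec₀` (★ Σ-core ∘ §1). [cite: Rogawski1990, §12.5 pp. 182, 186–187; §4.3 (4.3.1) p. 43] -/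
theorem isTwistedWeylMeasure_stableCartanMeasure_of_sheetJacobians (hns : ∀ w : PlacesOver L v, IsCMField.complexConj L • w.1 = w.1)
    [LocallyCompactSpace (GtLoc L v)] [SecondCountableTopology (GtLoc L v)] [T2Space (GtLoc L v)]
    [MeasurableSpace (GtLoc L v)] [BorelSpace (GtLoc L v)] [MeasurableSpace (Gqs L v)] [BorelSpace (Gqs L v)]
    [∀ δ : GtLoc L v, MeasurableSpace (GtLoc L v ⧸ epsCentralizer (epsLoc L (splitFormGL L) v) δ)] [∀ δ : GtLoc L v, BorelSpace (GtLoc L v ⧸ epsCentralizer (epsLoc L (splitFormGL L) v) δ)]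
    (νGt : Measure (GtLoc L v)) [νGt.IsHaarMeasure] [νGt.IsMulRightInvariant]
    (mGt : EpsOrbitalMeasureFamily (epsLoc L (splitFormGL L) v) ⊥) (hcan : IsEpsCanonicalAt L (splitFormGL L) v νGt mGt)
    {C : Finset (Subgroup (Gqs L v))}
    (hZ : ∀ T ∈ C, ∃ γ₀ : Gqs L v, IsRegularElt (γ₀.val : GL (Fin 3) (LocalRing L v)) ∧ T = Subgroup.centralizer ({γ₀} : Set (Gqs L v)))
    (hcov : ∀ γ : Gqs L v, IsRegularElt (γ.val : GL (Fin 3) (LocalRing L v)) →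
      ∃ T ∈ C, ∃ x : Gqs L v, ∀ g : Gqs L v, g ∈ Subgroup.centralizer ({γ} : Set (Gqs L v)) ↔ x⁻¹ * g * x ∈ T)
    (hirr : ∀ T ∈ C, ∀ T' ∈ C, T ≠ T' → ∀ y : Gqs L v, ¬ ∀ h : Gqs L v, h ∈ T' ↔ y⁻¹ * h * y ∈ T)
    (tT : ∀ i : ↥C, Measure ↥(i : Subgroup (Gqs L v))) (htH : ∀ i : ↥C, (tT i).IsHaarMeasure)
    (htc : ∀ i : ↥C, tT i (compactCore ↥(i : Subgroup (Gqs L v))) = 1)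
    {n : Gqs L v → ℕ} (hdict : IsStableTransportDict L v C n)
    (hsing : νGt {δ : GtLoc L v | ¬ IsEpsRegularAt L (splitFormGL L) v δ} = 0)
    (sec₀ : Gqs L v → GtLoc L v) (hsec₀ : ∀ γ : Gqs L v, IsEpsNormPair L (splitFormGL L) v (sec₀ γ) γ)
    (hwc : IsTwistedWeylCountT L v C n)
    (hJac : ∀ (i : ↥C) (γ₀ : Gqs L v), IsRegularElt (γ₀.val : GtLoc L v) → (i : Subgroup (Gqs L v)) = Subgroup.centralizer ({γ₀} : Set (Gqs L v)) →
      ∀ ⦃δ₀ : GtLoc L v⦄ (hδ₀T : δ₀ ∈ (Subgroup.centralizer ({(γ₀.val : GtLoc L v)} : Set (GtLoc L v)))) (hδ₀reg : IsEpsRegularAt L (splitFormGL L) v δ₀)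
      (τ' : Measure ↥(epsCentralizer (epsLoc L (splitFormGL L) v) δ₀)) [τ'.IsHaarMeasure] [τ'.IsInvInvariant]
      (h1 : τ' (compactCore ↥(epsCentralizer (epsLoc L (splitFormGL L) v) δ₀)) = 1)
      (Ψ : (GtLoc L v ⧸ epsCentralizer (epsLoc L (splitFormGL L) v) δ₀) × ↥(Subgroup.centralizer ({(γ₀.val : GtLoc L v)} : Set (GtLoc L v))) → GtLoc L v)
      (hΨ : ∀ (x : GtLoc L v) (b : ↥(Subgroup.centralizer ({(γ₀.val : GtLoc L v)} : Set (GtLoc L v)))), Ψ (QuotientGroup.mk x, b) = x * b * ((epsLoc L (splitFormGL L) v) x)⁻¹)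
      (N' : Subgroup (GtLoc L v))
      (hN' : ∀ m, m ∈ N' ↔ m ∈ Subgroup.normalizer ((Subgroup.centralizer ({(γ₀.val : GtLoc L v)} : Set (GtLoc L v))) : Set (GtLoc L v)) ∧ m * ((epsLoc L (splitFormGL L) v) m)⁻¹ ∈ (Subgroup.centralizer ({(γ₀.val : GtLoc L v)} : Set (GtLoc L v))))
      (s : ↥(i : Subgroup (Gqs L v)) → ↥(Subgroup.centralizer ({(γ₀.val : GtLoc L v)} : Set (GtLoc L v)))) (hsm : Measurable s) (hsN : ∀ t : ↥(i : Subgroup (Gqs L v)), epsNorm (epsLoc L (splitFormGL L) v) (s t : GtLoc L v) = ((t : Gqs L v)).val)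
      (R : Finset ↥(Subgroup.centralizer ({(γ₀.val : GtLoc L v)} : Set (GtLoc L v)))) (hRN : ∀ u ∈ R, epsNorm (epsLoc L (splitFormGL L) v) (u : GtLoc L v) = 1)
      (hRcov : ∀ w : ↥(Subgroup.centralizer ({(γ₀.val : GtLoc L v)} : Set (GtLoc L v))), epsNorm (epsLoc L (splitFormGL L) v) (w : GtLoc L v) = 1 → ∃ u ∈ R, ∃ a : ↥(Subgroup.centralizer ({(γ₀.val : GtLoc L v)} : Set (GtLoc L v))), (w : GtLoc L v) = u * (a * ((epsLoc L (splitFormGL L) v) a)⁻¹))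
      (hRinj : ∀ u ∈ R, ∀ u' ∈ R, (∃ a : ↥(Subgroup.centralizer ({(γ₀.val : GtLoc L v)} : Set (GtLoc L v))), ((u' : ↥(Subgroup.centralizer ({(γ₀.val : GtLoc L v)} : Set (GtLoc L v)))) : GtLoc L v) = u * (a * ((epsLoc L (splitFormGL L) v) a)⁻¹)) → u = u'),
      ∀ t₁ : ↥(i : Subgroup (Gqs L v)), IsRegularElt (((t₁ : Gqs L v)).val : GtLoc L v) →
        ∃ U : Set ↥(i : Subgroup (Gqs L v)), IsOpen U ∧ t₁ ∈ U ∧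
        ∃ A₀ : Set (GtLoc L v ⧸ epsCentralizer (epsLoc L (splitFormGL L) v) δ₀), MeasurableSet A₀ ∧ (Literature.MeasureTheory.Group.quotientMeasure (epsCentralizer (epsLoc L (splitFormGL L) v) δ₀) τ' (isClosed_epsCentralizer L (splitFormGL L) v δ₀) νGt) A₀ ≠ 0 ∧ (Literature.MeasureTheory.Group.quotientMeasure (epsCentralizer (epsLoc L (splitFormGL L) v) δ₀) τ' (isClosed_epsCentralizer L (splitFormGL L) v δ₀) νGt) A₀ ≠ ⊤ ∧
          ∀ u ∈ R, ∀ V : Set ↥(i : Subgroup (Gqs L v)), MeasurableSet V → V ⊆ U ∩ {t : ↥(i : Subgroup (Gqs L v)) | IsRegularElt (((t : Gqs L v)).val : GtLoc L v)} →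
            νGt (Ψ '' (A₀ ×ˢ ((fun t : ↥(i : Subgroup (Gqs L v)) => s t * u) '' V))) = (Literature.MeasureTheory.Group.quotientMeasure (epsCentralizer (epsLoc L (splitFormGL L) v) δ₀) τ' (isClosed_epsCentralizer L (splitFormGL L) v δ₀) νGt) A₀ * ∫⁻ t in V, (cartanWeight L v (i : Subgroup (Gqs L v)) t : ℝ≥0∞) ∂(tT i)) :
    IsTwistedWeylMeasure L (splitFormGL L) v νGt mGt (stableCartanMeasure L v C tT n) sec₀ := by
  haveI : ∀ i : ↥C, (tT i).IsHaarMeasure := htH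
  exact isTwistedWeylMeasure_stableCartanMeasure_of_oneTubeFormulas L v hns hZ hcov hirr tT htH htc hdict νGt hsing mGt sec₀ hsec₀ hwc
    fun i γ₀ hγ₀ hT => oneTubeFormula_of_sheetJacobian L v hns νGt mGt hcan hγ₀ hT (tT i) sec₀ hsec₀ (hJac i γ₀ hγ₀ hT)

/-- **… WITH SING-ε DISCHARGED** (non-split `v`: ★ p864222 `measure_setOf_not_isEpsRegularAt_splitFormGL_eq_zero`). [cite: Rogawski1990, §12.5 p. 186; §12.2 p. 171] -/
theorem isTwistedWeylMeasure_stableCartanMeasure_of_sheetJacobians_nonsplit (hns : ∀ w : PlacesOver L v, IsCMField.complexConj L • w.1 = w.1)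
    [LocallyCompactSpace (GtLoc L v)] [SecondCountableTopology (GtLoc L v)] [T2Space (GtLoc L v)]
    [MeasurableSpace (GtLoc L v)] [BorelSpace (GtLoc L v)] [MeasurableSpace (Gqs L v)] [BorelSpace (Gqs L v)]
    [∀ δ : GtLoc L v, MeasurableSpace (GtLoc L v ⧸ epsCentralizer (epsLoc L (splitFormGL L) v) δ)] [∀ δ : GtLoc L v, BorelSpace (GtLoc L v ⧸ epsCentralizer (epsLoc L (splitFormGL L) v) δ)]
    (νGt : Measure (GtLoc L v)) [νGt.IsHaarMeasure] [νGt.IsMulRightInvariant]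
    (mGt : EpsOrbitalMeasureFamily (epsLoc L (splitFormGL L) v) ⊥) (hcan : IsEpsCanonicalAt L (splitFormGL L) v νGt mGt)
    {C : Finset (Subgroup (Gqs L v))}
    (hZ : ∀ T ∈ C, ∃ γ₀ : Gqs L v, IsRegularElt (γ₀.val : GL (Fin 3) (LocalRing L v)) ∧ T = Subgroup.centralizer ({γ₀} : Set (Gqs L v)))
    (hcov : ∀ γ : Gqs L v, IsRegularElt (γ.val : GL (Fin 3) (LocalRing L v)) →
      ∃ T ∈ C, ∃ x : Gqs L v, ∀ g : Gqs L v, g ∈ Subgroup.centralizer ({γ} : Set (Gqs L v)) ↔ x⁻¹ * g * x ∈ T)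
    (hirr : ∀ T ∈ C, ∀ T' ∈ C, T ≠ T' → ∀ y : Gqs L v, ¬ ∀ h : Gqs L v, h ∈ T' ↔ y⁻¹ * h * y ∈ T)
    (tT : ∀ i : ↥C, Measure ↥(i : Subgroup (Gqs L v))) (htH : ∀ i : ↥C, (tT i).IsHaarMeasure)
    (htc : ∀ i : ↥C, tT i (compactCore ↥(i : Subgroup (Gqs L v))) = 1)
    {n : Gqs L v → ℕ} (hdict : IsStableTransportDict L v C n)
    (sec₀ : Gqs L v → GtLoc L v) (hsec₀ : ∀ γ : Gqs L v, IsEpsNormPair L (splitFormGL L) v (sec₀ γ) γ)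
    (hwc : IsTwistedWeylCountT L v C n)
    (hJac : ∀ (i : ↥C) (γ₀ : Gqs L v), IsRegularElt (γ₀.val : GtLoc L v) → (i : Subgroup (Gqs L v)) = Subgroup.centralizer ({γ₀} : Set (Gqs L v)) →
      ∀ ⦃δ₀ : GtLoc L v⦄ (hδ₀T : δ₀ ∈ (Subgroup.centralizer ({(γ₀.val : GtLoc L v)} : Set (GtLoc L v)))) (hδ₀reg : IsEpsRegularAt L (splitFormGL L) v δ₀)
      (τ' : Measure ↥(epsCentralizer (epsLoc L (splitFormGL L) v) δ₀)) [τ'.IsHaarMeasure] [τ'.IsInvInvariant]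
      (h1 : τ' (compactCore ↥(epsCentralizer (epsLoc L (splitFormGL L) v) δ₀)) = 1)
      (Ψ : (GtLoc L v ⧸ epsCentralizer (epsLoc L (splitFormGL L) v) δ₀) × ↥(Subgroup.centralizer ({(γ₀.val : GtLoc L v)} : Set (GtLoc L v))) → GtLoc L v)
      (hΨ : ∀ (x : GtLoc L v) (b : ↥(Subgroup.centralizer ({(γ₀.val : GtLoc L v)} : Set (GtLoc L v)))), Ψ (QuotientGroup.mk x, b) = x * b * ((epsLoc L (splitFormGL L) v) x)⁻¹)
      (N' : Subgroup (GtLoc L v))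
      (hN' : ∀ m, m ∈ N' ↔ m ∈ Subgroup.normalizer ((Subgroup.centralizer ({(γ₀.val : GtLoc L v)} : Set (GtLoc L v))) : Set (GtLoc L v)) ∧ m * ((epsLoc L (splitFormGL L) v) m)⁻¹ ∈ (Subgroup.centralizer ({(γ₀.val : GtLoc L v)} : Set (GtLoc L v))))
      (s : ↥(i : Subgroup (Gqs L v)) → ↥(Subgroup.centralizer ({(γ₀.val : GtLoc L v)} : Set (GtLoc L v)))) (hsm : Measurable s) (hsN : ∀ t : ↥(i : Subgroup (Gqs L v)), epsNorm (epsLoc L (splitFormGL L) v) (s t : GtLoc L v) = ((t : Gqs L v)).val)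
      (R : Finset ↥(Subgroup.centralizer ({(γ₀.val : GtLoc L v)} : Set (GtLoc L v)))) (hRN : ∀ u ∈ R, epsNorm (epsLoc L (splitFormGL L) v) (u : GtLoc L v) = 1)
      (hRcov : ∀ w : ↥(Subgroup.centralizer ({(γ₀.val : GtLoc L v)} : Set (GtLoc L v))), epsNorm (epsLoc L (splitFormGL L) v) (w : GtLoc L v) = 1 → ∃ u ∈ R, ∃ a : ↥(Subgroup.centralizer ({(γ₀.val : GtLoc L v)} : Set (GtLoc L v))), (w : GtLoc L v) = u * (a * ((epsLoc L (splitFormGL L) v) a)⁻¹))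
      (hRinj : ∀ u ∈ R, ∀ u' ∈ R, (∃ a : ↥(Subgroup.centralizer ({(γ₀.val : GtLoc L v)} : Set (GtLoc L v))), ((u' : ↥(Subgroup.centralizer ({(γ₀.val : GtLoc L v)} : Set (GtLoc L v)))) : GtLoc L v) = u * (a * ((epsLoc L (splitFormGL L) v) a)⁻¹)) → u = u'),
      ∀ t₁ : ↥(i : Subgroup (Gqs L v)), IsRegularElt (((t₁ : Gqs L v)).val : GtLoc L v) →
        ∃ U : Set ↥(i : Subgroup (Gqs L v)), IsOpen U ∧ t₁ ∈ U ∧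
        ∃ A₀ : Set (GtLoc L v ⧸ epsCentralizer (epsLoc L (splitFormGL L) v) δ₀), MeasurableSet A₀ ∧ (Literature.MeasureTheory.Group.quotientMeasure (epsCentralizer (epsLoc L (splitFormGL L) v) δ₀) τ' (isClosed_epsCentralizer L (splitFormGL L) v δ₀) νGt) A₀ ≠ 0 ∧ (Literature.MeasureTheory.Group.quotientMeasure (epsCentralizer (epsLoc L (splitFormGL L) v) δ₀) τ' (isClosed_epsCentralizer L (splitFormGL L) v δ₀) νGt) A₀ ≠ ⊤ ∧
          ∀ u ∈ R, ∀ V : Set ↥(i : Subgroup (Gqs L v)), MeasurableSet V → V ⊆ U ∩ {t : ↥(i : Subgroup (Gqs L v)) | IsRegularElt (((t : Gqs L v)).val : GtLoc L v)} →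
            νGt (Ψ '' (A₀ ×ˢ ((fun t : ↥(i : Subgroup (Gqs L v)) => s t * u) '' V))) = (Literature.MeasureTheory.Group.quotientMeasure (epsCentralizer (epsLoc L (splitFormGL L) v) δ₀) τ' (isClosed_epsCentralizer L (splitFormGL L) v δ₀) νGt) A₀ * ∫⁻ t in V, (cartanWeight L v (i : Subgroup (Gqs L v)) t : ℝ≥0∞) ∂(tT i)) :
    IsTwistedWeylMeasure L (splitFormGL L) v νGt mGt (stableCartanMeasure L v C tT n) sec₀ :=
  isTwistedWeylMeasure_stableCartanMeasure_of_sheetJacobians L v hns νGt mGt hcan hZ hcov hirr tT htH htc hdict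
    (measure_setOf_not_isEpsRegularAt_splitFormGL_eq_zero L v hns νGt) sec₀ hsec₀ hwc hJac

end HeadUnderLetter3

end Summit.HodgeConjecture.HodgeConjecture.R90.S4

end
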